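import Summits.HubbardSuperconductivity.HubbardSuperconductivity.Theses.BcsKacWindow

/-!
# Route `BcsKacWindow`, crux `CoherenceWindowLRO` — the bulk sandwich (logical calibration)

Helper file for the crux item `stmt-HubbardSuperconductivity-1319` (`CoherenceWindowLRO`, rank 2 of
route `BcsKacWindow`). It records, as tree theorems, where the crux AS TYPED sits relative to plain
bulk statements of weak-coupling `d_{x²-y²}` order:

* `coherenceWindowLRO_of_bulkLRO_at_bcs_rate` — the typed crux is IMPLIED by bulk pair-field order at a
  BCS rate that is locally uniform in the doping: if for `δ ∈ [a,b]`, `U ∈ (0,U₀)` every normalised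
  sector ground state on every even torus of side `L ≥ C·e^{κ/U²}` has
  `L⁻⁴ Re⟨ψ, Δ_d†Δ_d ψ⟩ ≥ c·(e^{-κ/U²})²`, then `CoherenceWindowLRO` holds with the pinned gap scale
  `Δ(U) := e^{-κ/U²}` (`κ₁ = κ₂ = κ`), `c₀ := c`, `s₀ := C` and `U₁(s) := U₀` for EVERY window top `s`
  (the window's upper end is simply not used). So the coherence window, as typed (one `Δ` for all
  dopings, `c₀` uniform in `s`, `U₁` depending on `s`), is not logically stronger than uniform-rate bulk
  order — it is a consequence of it; this is the formal half of the refuters' standing objection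
  (item notes 2026-08-15: "the typed statement is implied by strong forms of S").
* `target_with_rate_of_bulkLRO_at_bcs_rate` — the same hypothesis gives the route's corner `Target`
  directly (without `InfraredCompletion`).

No definition and no named fact is introduced: the bulk hypothesis is an explicit antecedent, never
asserted. Elementary bookkeeping (`Real.exp_pos`, `div_le_iff`). [folklore]
-/

-- the mandated namespace `Summit.<Summit>.<Problem>.Theorems` repeats `HubbardSuperconductivity`
-- (single-problem summit, D-0017), which the `dupNamespace` linter flags on every declaration
set_option linter.dupNamespace false

namespace Summit.HubbardSuperconductivity.HubbardSuperconductivity.Theorems.BcsKacWindow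

open Matrix Literature.MathematicalPhysics.QuantumLattice
open Summit.HubbardSuperconductivity.HubbardSuperconductivity.Theses.BcsKacWindow

/-- **Bulk order at a BCS rate implies the typed coherence window.** Hypothesis (an explicit
antecedent, not asserted): there are a doping interval `[a,b] ⊂ (0,1/2)`, an exponent `κ > 0`,
constants `c, C, U₀ > 0` such that for `δ ∈ [a,b]`, `U ∈ (0,U₀)`, every even `L` with
`C · e^{κ/U²} ≤ L` and every normalised `(2⌊(1-δ)L²/2⌋, S^z = 0)`-sector ground state `ψ` of
`hubbardTorus 2 L 1 U`: `c · (e^{-κ/U²})² ≤ L⁻⁴ Re⟨ψ, Δ_d† Δ_d ψ⟩`. Conclusion: the crux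
`CoherenceWindowLRO` (by name), with witnesses `Δ(U) := e^{-κ/U²}`, `κ₁ = κ₂ := κ`, `c₀ := c`,
`s₀ := C`, and `U₁(s) := U₀` for every `s` — the upper window bound `Δ(U)·L ≤ s` is discarded.
[folklore] -/
theorem coherenceWindowLRO_of_bulkLRO_at_bcs_rate :
    (∃ a b κ c C U₀ : ℝ, 0 < a ∧ a < b ∧ b < 1 / 2 ∧ 0 < κ ∧ 0 < c ∧ 0 < C ∧ 0 < U₀ ∧
      ∀ δ ∈ Set.Icc a b, ∀ U ∈ Set.Ioo (0 : ℝ) U₀, ∀ (L : ℕ) [NeZero L], Even L →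
        C * Real.exp (κ / U ^ 2) ≤ L →
          ∀ ψ : Fock (Orb (FermionTorus 2 L)), star ψ ⬝ᵥ ψ = 1 →
            IsGroundStateInSector (hubbardTorus 2 L 1 U) (2 * ⌊(1 - δ) * (L : ℝ) ^ 2 / 2⌋₊) 0 ψ →
              c * Real.exp (-(κ / U ^ 2)) ^ 2 ≤
                (expect ((pairField dWaveFormFactor L)ᴴ * pairField dWaveFormFactor L) ψ).re /
                  (L : ℝ) ^ 4) →
    CoherenceWindowLRO := by
  intro h
  obtain ⟨a, b, κ, c, C, U₀, ha, hab, hb, hκ, hc, hC, hU₀, hbulk⟩ := h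
  refine ⟨a, b, κ, κ, c, C, fun U => Real.exp (-(κ / U ^ 2)), ha, hab, hb, hκ, le_rfl, hc, hC,
    fun U _ => ⟨le_rfl, le_rfl⟩, ?_⟩
  intro s _
  refine ⟨U₀, hU₀, ?_⟩
  intro δ hδ U hU L _ hE hlo _ ψ hψ hgs
  refine hbulk δ hδ U hU L hE ?_ ψ hψ hgs
  -- window bottom `C ≤ e^{-κ/U²} · L` is `C · e^{κ/U²} ≤ L`
  have hexp : Real.exp (κ / U ^ 2) * Real.exp (-(κ / U ^ 2)) = 1 := by
    rw [← Real.exp_add, add_neg_cancel, Real.exp_zero]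
  have hpos : 0 < Real.exp (κ / U ^ 2) := Real.exp_pos _
  calc C * Real.exp (κ / U ^ 2) ≤ Real.exp (-(κ / U ^ 2)) * L * Real.exp (κ / U ^ 2) :=
        mul_le_mul_of_nonneg_right hlo hpos.le
    _ = L := by rw [mul_comm, ← mul_assoc, hexp, one_mul]

/-- **The same bulk hypothesis gives the route's corner `Target` directly** (by name), with
`U₀` unchanged and, at `(δ, U)`, `c_T := c · (e^{-κ/U²})² > 0`, `L₀ := C · e^{κ/U²}`. Recorded next to
`coherenceWindowLRO_of_bulkLRO_at_bcs_rate` to make the sandwich explicit: uniform-rate bulk order ⇒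
(`CoherenceWindowLRO` and `Target`), while `CoherenceWindowLRO ∧ InfraredCompletion ⇒ Target` is the
route's `TargetOfWindow`. [folklore] -/
theorem target_of_bulkLRO_at_bcs_rate :
    (∃ a b κ c C U₀ : ℝ, 0 < a ∧ a < b ∧ b < 1 / 2 ∧ 0 < κ ∧ 0 < c ∧ 0 < C ∧ 0 < U₀ ∧
      ∀ δ ∈ Set.Icc a b, ∀ U ∈ Set.Ioo (0 : ℝ) U₀, ∀ (L : ℕ) [NeZero L], Even L →
        C * Real.exp (κ / U ^ 2) ≤ L →
          ∀ ψ : Fock (Orb (FermionTorus 2 L)), star ψ ⬝ᵥ ψ = 1 →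
            IsGroundStateInSector (hubbardTorus 2 L 1 U) (2 * ⌊(1 - δ) * (L : ℝ) ^ 2 / 2⌋₊) 0 ψ →
              c * Real.exp (-(κ / U ^ 2)) ^ 2 ≤
                (expect ((pairField dWaveFormFactor L)ᴴ * pairField dWaveFormFactor L) ψ).re /
                  (L : ℝ) ^ 4) →
    Target := by
  intro h
  obtain ⟨a, b, κ, c, C, U₀, ha, hab, hb, hκ, hc, hC, hU₀, hbulk⟩ := h
  refine ⟨a, b, U₀, ha, hab, hb, hU₀, ?_⟩
  intro δ hδ U hU
  refine ⟨c * Real.exp (-(κ / U ^ 2)) ^ 2, C * Real.exp (κ / U ^ 2),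
    mul_pos hc (pow_pos (Real.exp_pos _) 2), ?_⟩
  intro L _ hE hL₀ ψ hψ hgs
  exact hbulk δ hδ U hU L hE hL₀ ψ hψ hgs

end Summit.HubbardSuperconductivity.HubbardSuperconductivity.Theorems.BcsKacWindow
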